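import Literature.LinearAlgebra.Matrix.CentraliserOfSeparableCharpoly
import Mathlib.LinearAlgebra.Matrix.NonsingularInverse
import HarnessLib

/-!
# Eigencharacters of the commutant of a matrix with separable characteristic polynomial

Topic `LinearAlgebra/Matrix`; namespace `Literature.LinearAlgebra.Matrix`.  PROOF FILE over Mathlib and ★ `CentraliserOfSeparableCharpoly` only:
theorems, no definition, no named fact, no instance, no notation, no `sorry`.

A square matrix `g ∈ M_n(K)` over a field `K` whose characteristic polynomial is SEPARABLE is regular semisimple: over an algebraically closed extension
`L ⊇ K` it has an eigenbasis `b` with pairwise distinct eigenvalues, on which every matrix `a` commuting with `g` acts DIAGONALLY (★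
`apply_eigenbasis_eq_smul_of_commute`).  Reading off the diagonal entries gives `n` maps `χ_i : M_n(K) → L` («eigencharacters»), `K`-linear on all of
`M_n(K)` and MULTIPLICATIVE on the commutant `C(g)` of `g`, with `χ_i(1) = 1`, `χ_i(g)` pairwise distinct, and — the point — the characteristic polynomial
of every `a ∈ C(g)` SPLITS as `∏_i (X − χ_i(a))` over `L`.  Hence `a ∈ C(g)` has separable characteristic polynomial iff the `χ_i(a)` are pairwise distinct:
the SINGULAR LOCUS of the commutant is the union of the «root hyperplanes» `{χ_i = χ_j}`, `i ≠ j` — the linear-algebra half of «the singular set of a Cartan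
subgroup `T = Z(γ)` is the union of its root kernels» ([Rogawski1990, §3.6]; [HarishChandra1970, Lemma 42]; [Borel1991, IV.12.2]).

* `exists_eigencharacters` — the existence statement with the five properties (unit, `K`-linearity is built in, multiplicativity on `C(g)`, injectivity at `g`,
  splitting of `charpoly a` for `a ∈ C(g)`);
* consumers' corollaries, stated for ANY family `χ` with the splitting property: `charpoly_separable_iff_injective_of_splits`,
  `exists_eq_of_not_separable_of_splits` (a singular `a ∈ C(g)` has two equal eigencharacters), `mul_inv_eigencharacter_of_isUnit` (`χ_i(a) χ_i(a⁻¹) = 1`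
  for a unit `a ∈ C(g)`), `eigencharacter_ne_zero_of_isUnit`.

## References
* [Rogawski1990] J. D. Rogawski, *Automorphic Representations of Unitary Groups in Three Variables*, Ann. of Math. Stud. 123 (1990), §3.1 p. 19, §3.6.
* [Borel1991] A. Borel, *Linear Algebraic Groups*, 2nd ed. (1991), IV.12.2 (regular semisimple elements, roots of a torus).
* [HarishChandra1970] Harish-Chandra (notes by G. van Dijk), *Harmonic Analysis on Reductive p-adic Groups*, LNM 162 (1970), Lemma 42.
-/

set_option autoImplicit false

namespace Literature.LinearAlgebra.Matrix

open Polynomial Module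

section Eigencharacters

variable {K L : Type*} [Field K] [Field L] [Algebra K L] {n : Type*} [Fintype n] [DecidableEq n]

/-- **Eigencharacters of the commutant.**  Let `g ∈ M_n(K)` have separable characteristic polynomial and let `L ⊇ K` be algebraically closed.  There are
`K`-linear maps `χ_i : M_n(K) → L` (`i : n`) with `χ_i(1) = 1`, MULTIPLICATIVE on the commutant of `g`, taking pairwise DISTINCT values at `g`, such that the
characteristic polynomial of every `a` commuting with `g` is `∏_i (X − χ_i(a))` over `L` (the `χ_i(a)` are the diagonal entries of `a` on an eigenbasis of
`g` over `L`, ★ `apply_eigenbasis_eq_smul_of_commute`). [cite: Borel1991, IV.12.2] [cite: Rogawski1990, §3.1 p. 19] -/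
theorem exists_eigencharacters [IsAlgClosed L] (g : _root_.Matrix n n K) (hsep : g.charpoly.Separable) :
    ∃ χ : n → (_root_.Matrix n n K →ₗ[K] L),
      (∀ i, χ i 1 = 1) ∧
      (∀ i (a c : _root_.Matrix n n K), Commute a g → Commute c g → χ i (a * c) = χ i a * χ i c) ∧
      Function.Injective (fun i => χ i g) ∧
      ∀ a : _root_.Matrix n n K, Commute a g →
        (a.charpoly).map (algebraMap K L) = ∏ i, (X - C (χ i a)) := by
  classical
  set φ : K →+* L := algebraMap K L with hφ
  -- the base-changed endomorphism and its eigenbasis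
  set f : End L (n → L) := _root_.Matrix.toLin' (g.map φ) with hf
  have hchar : f.charpoly = (g.charpoly).map φ := by
    rw [hf, ← LinearMap.charpoly_toMatrix (_root_.Matrix.toLin' (g.map φ)) (Pi.basisFun L n), LinearMap.toMatrix_eq_toMatrix',
      LinearMap.toMatrix'_toLin', _root_.Matrix.charpoly_map]
  have hsepf : f.charpoly.Separable := by rw [hchar]; exact hsep.map
  set S := f.charpoly.roots.toFinset with hS
  have hv : ∀ μ : S, ∃ v : n → L, f.HasEigenvector (μ : L) v :=
    fun μ => exists_hasEigenvector_of_mem_roots f (Multiset.mem_toFinset.mp μ.2)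
  choose v hv using hv
  have hli : LinearIndependent L v :=
    f.eigenvectors_linearIndependent' (fun μ : S => (μ : L)) Subtype.val_injective v hv
  have hcardS : Fintype.card S = Module.finrank L (n → L) := by
    rw [Fintype.card_coe, hS, Multiset.toFinset_card_of_nodup (nodup_roots hsepf), card_roots_charpoly_eq_finrank f]
  have hcardn : Fintype.card S = Fintype.card n := by rw [hcardS, Module.finrank_fintype_fun_eq_card]
  let e : S ≃ n := Fintype.equivOfCardEq hcardn
  let b₀ : Basis S L (n → L) := basisOfLinearIndependentOfCardEqFinrank' v hli hcardS
  have hb₀v : ∀ μ : S, b₀ μ = v μ := fun μ => by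
    simp only [b₀, basisOfLinearIndependentOfCardEqFinrank', Basis.mk_apply]
  let b : Basis n L (n → L) := b₀.reindex e
  let μ : n → L := fun i => ((e.symm i : S) : L)
  have hμ : Function.Injective μ := fun i j hij => e.symm.injective (Subtype.val_injective hij)
  have hb : ∀ i, f (b i) = μ i • b i := fun i => by
    simp only [b, Basis.reindex_apply, hb₀v]
    exact (hv (e.symm i)).apply_eq_smul
  -- the base change `a ↦ toLin' (a.map φ)` and the eigencharacters
  let Φ : _root_.Matrix n n K → End L (n → L) := fun a => _root_.Matrix.toLin' (a.map φ)
  have hΦadd : ∀ a c, Φ (a + c) = Φ a + Φ c := fun a c => by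
    simp only [Φ, _root_.Matrix.map_add φ (map_add φ), map_add]
  have hΦsmul : ∀ (k : K) a, Φ (k • a) = φ k • Φ a := fun k a => by
    simp only [Φ]
    rw [show (k • a).map φ = φ k • a.map φ from by ext i j; simp [_root_.Matrix.map_apply, smul_eq_mul], map_smul]
  have hΦmul : ∀ a c, Φ (a * c) = Φ a * Φ c := fun a c => by
    simp only [Φ, _root_.Matrix.map_mul, _root_.Matrix.toLin'_mul]
    rfl
  have hΦone : Φ 1 = 1 := by
    simp only [Φ, _root_.Matrix.map_one φ (map_zero φ) (map_one φ), _root_.Matrix.toLin'_one]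
    rfl
  have hΦg : Φ g = f := rfl
  have hΦcomm : ∀ a, Commute a g → Commute (Φ a) f := fun a ha => by
    rw [← hΦg]
    change Φ a * Φ g = Φ g * Φ a
    rw [← hΦmul, ← hΦmul, ha.eq]
  let χf : n → _root_.Matrix n n K → L := fun i a => b.repr (Φ a (b i)) i
  have hadd : ∀ i a c, χf i (a + c) = χf i a + χf i c := fun i a c => by
    simp only [χf, hΦadd, LinearMap.add_apply, map_add, Finsupp.add_apply]
  have hsmul : ∀ i (k : K) a, χf i (k • a) = k • χf i a := fun i k a => by
    simp only [χf, hΦsmul, LinearMap.smul_apply, map_smul, Finsupp.smul_apply, smul_eq_mul]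
    rw [Algebra.smul_def]
  let χ : n → (_root_.Matrix n n K →ₗ[K] L) := fun i =>
    { toFun := χf i, map_add' := hadd i, map_smul' := hsmul i }
  have hχ : ∀ i a, χ i a = b.repr (Φ a (b i)) i := fun _ _ => rfl
  -- diagonal action of the commutant
  have hdiag : ∀ a, Commute a g → ∀ i, Φ a (b i) = χ i a • b i := fun a ha i => by
    rw [hχ]
    exact apply_eigenbasis_eq_smul_of_commute f b μ hμ hb (hΦcomm a ha) i
  refine ⟨χ, fun i => ?_, fun i a c ha hc => ?_, ?_, fun a ha => ?_⟩
  · -- `χ_i(1) = 1`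
    rw [hχ, hΦone, Module.End.one_apply, b.repr_self, Finsupp.single_eq_same]
  · -- multiplicativity on the commutant
    have h1 : Φ (a * c) (b i) = (χ i a * χ i c) • b i := by
      rw [hΦmul, Module.End.mul_apply, hdiag c hc i, map_smul, hdiag a ha i, smul_smul, mul_comm]
    rw [hχ i (a * c), h1, map_smul, Finsupp.smul_apply, b.repr_self, Finsupp.single_eq_same, smul_eq_mul, mul_one]
  · -- `χ_i(g) = μ_i` are pairwise distinct
    have hg : ∀ i, χ i g = μ i := fun i => by
      rw [hχ, hΦg, hb i, map_smul, Finsupp.smul_apply, b.repr_self, Finsupp.single_eq_same, smul_eq_mul, mul_one]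
    intro i j hij
    simp only [hg] at hij
    exact hμ hij
  · -- the characteristic polynomial of `a ∈ C(g)` splits along the eigencharacters
    have hmat : LinearMap.toMatrix b b (Φ a) = _root_.Matrix.diagonal fun i => χ i a := by
      ext i j
      rw [LinearMap.toMatrix_apply, hdiag a ha j, map_smul, Finsupp.smul_apply, b.repr_self, _root_.Matrix.diagonal_apply,
        Finsupp.single_apply, smul_eq_mul]
      by_cases h : i = j
      · subst h; simp
      · rw [if_neg (Ne.symm h), if_neg h, mul_zero]
    have h1 : (Φ a).charpoly = (a.charpoly).map φ := by
      simp only [Φ]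
      rw [← LinearMap.charpoly_toMatrix (_root_.Matrix.toLin' (a.map φ)) (Pi.basisFun L n), LinearMap.toMatrix_eq_toMatrix',
        LinearMap.toMatrix'_toLin', _root_.Matrix.charpoly_map]
    rw [← h1, ← LinearMap.charpoly_toMatrix (Φ a) b, hmat, _root_.Matrix.charpoly_diagonal]

/-- **Separable ⟺ distinct eigencharacters.**  If the characteristic polynomial of `a ∈ M_n(K)` splits over a field extension `L` as `∏_i (X − x_i)`,
then it is separable iff the `x_i` are pairwise distinct (Mathlib `Polynomial.separable_map`, `Polynomial.separable_prod_X_sub_C_iff`).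
[cite: Borel1991, IV.12.2] -/
theorem charpoly_separable_iff_injective_of_splits (a : _root_.Matrix n n K) (x : n → L)
    (hx : (a.charpoly).map (algebraMap K L) = ∏ i, (X - C (x i))) :
    a.charpoly.Separable ↔ Function.Injective x := by
  rw [← Polynomial.separable_map (algebraMap K L), hx, Polynomial.separable_prod_X_sub_C_iff]

/-- **A singular element has two equal eigencharacters**: if `charpoly a = ∏_i (X − x_i)` over `L` and `charpoly a` is NOT separable, then `x_i = x_j`
for some `i ≠ j`. [cite: Borel1991, IV.12.2] [cite: HarishChandra1970, Lemma 42] -/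
theorem exists_eq_of_not_separable_of_splits (a : _root_.Matrix n n K) (x : n → L)
    (hx : (a.charpoly).map (algebraMap K L) = ∏ i, (X - C (x i))) (ha : ¬ a.charpoly.Separable) :
    ∃ i j : n, i ≠ j ∧ x i = x j := by
  rw [charpoly_separable_iff_injective_of_splits a x hx, Function.Injective] at ha
  push Not at ha
  obtain ⟨i, j, hij, hne⟩ := ha
  exact ⟨i, j, hne, hij⟩

/-- **Eigencharacters of a unit of the commutant**: if `χ` is multiplicative on the commutant of `g` with `χ 1 = 1`, then for a UNIT `a` commuting with
`g`, `χ(a) · χ(a⁻¹) = 1` (the inverse commutes with `g` as well). [cite: Borel1991, IV.12.2] -/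
theorem mul_eigencharacter_inv_of_isUnit {g : _root_.Matrix n n K} (χ : _root_.Matrix n n K →ₗ[K] L) (h1 : χ 1 = 1)
    (hmul : ∀ a c : _root_.Matrix n n K, Commute a g → Commute c g → χ (a * c) = χ a * χ c)
    {a : _root_.Matrix n n K} (ha : Commute a g) (hu : IsUnit a) : χ a * χ a⁻¹ = 1 := by
  have hdet : IsUnit a.det := (a.isUnit_iff_isUnit_det).1 hu
  have hinv : Commute a⁻¹ g := by
    obtain ⟨u, rfl⟩ := hu
    rw [← _root_.Matrix.coe_units_inv]
    exact Commute.units_inv_left ha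
  rw [← hmul a a⁻¹ ha hinv, a.mul_nonsing_inv hdet, h1]

/-- The eigencharacters of a unit of the commutant are non-zero. [cite: Borel1991, IV.12.2] -/
theorem eigencharacter_ne_zero_of_isUnit {g : _root_.Matrix n n K} (χ : _root_.Matrix n n K →ₗ[K] L) (h1 : χ 1 = 1)
    (hmul : ∀ a c : _root_.Matrix n n K, Commute a g → Commute c g → χ (a * c) = χ a * χ c)
    {a : _root_.Matrix n n K} (ha : Commute a g) (hu : IsUnit a) : χ a ≠ 0 := by
  intro h
  have := mul_eigencharacter_inv_of_isUnit χ h1 hmul ha hu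
  rw [h, zero_mul] at this
  exact zero_ne_one this

/-- `χ(a⁻¹) = χ(a)⁻¹` for a unit `a` of the commutant. [cite: Borel1991, IV.12.2] -/
theorem eigencharacter_inv_of_isUnit {g : _root_.Matrix n n K} (χ : _root_.Matrix n n K →ₗ[K] L) (h1 : χ 1 = 1)
    (hmul : ∀ a c : _root_.Matrix n n K, Commute a g → Commute c g → χ (a * c) = χ a * χ c)
    {a : _root_.Matrix n n K} (ha : Commute a g) (hu : IsUnit a) : χ a⁻¹ = (χ a)⁻¹ := by
  have h := mul_eigencharacter_inv_of_isUnit χ h1 hmul ha hu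
  have hne := eigencharacter_ne_zero_of_isUnit χ h1 hmul ha hu
  field_simp
  rw [mul_comm] at h
  exact h

end Eigencharacters

end Literature.LinearAlgebra.Matrix
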